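import Literature.Topology.FourManifolds.PontryaginThomCollapse
import Literature.Topology.FourManifolds.NeckCapping
import Literature.Geometry.Manifold.SmoothEmbeddingInverse
import Literature.Analysis.Calculus.SardProofs
import Mathlib.Geometry.Manifold.SmoothApprox
import HarnessLib

/-!
# The transversality step of Kervaire–Milnor's Lemma 4.2: a regular level bounding the tube

Topic `Literature/Topology/FourManifolds`; first `(b)`-specific step of the proof of the named
fact `Literature.Topology.FourManifolds.boundsParallelizable_of_collapseNullHomotopic`
(`PontryaginThomCollapse.lean`; Kervaire–Milnor, *Groups of homotopy spheres I*, Ann. of Math.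
77 (1963), Lemma 4.2, `⇒`, p. 510: *"if `p(M, φ) ≃ 0`, then `M` bounds a manifold
`W ⊂ Dⁿ⁺ᵏ⁺¹`"*; Kosinski, *Differential Manifolds* (1993), IX (5.5) and IV (1.4): make the
null-homotopy smooth and transverse to a point, and take the preimage).

Given a framed tubular embedding `E` of a compact `M` into `Sⁿ⁺ᵏ` whose Pontryagin–Thom collapse
`p(M, φ) : Sⁿ⁺ᵏ → ℝᵏ ∪ {∞}` is null-homotopic by `H`, we read the homotopy radially on
`ℝᴺ ∖ 0 ≅ Sⁿ⁺ᵏ × ℝ` (`N = n + k + 1`; time `τ(p) = 4‖p‖ - 5` clamped to `[0, 1]`, so that the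
collapse itself is read on the shell `‖p‖ < 5/4`), cut it off to an everywhere defined continuous
`f : ℝᴺ → ℝᵏ` which on the cone over the tube `M × B(0, 3)` and near the unit sphere *is* the
normal coordinate `v` of the tube (a `C^∞` function there), approximate it by a `C^∞` map `g`
within `1/8` keeping `g = f` on the cone over `M × B̄(0, 2)` between radii `3/4` and `9/8`
(Mathlib's `Continuous.exists_contDiff_approx_and_eqOn`), and pick by Sard's theorem (the tree's
`Literature.Analysis.Calculus.sard_holds`) a regular value `y` of `g` with `‖y‖ < 1/8`.  The
result (`FramedTubularEmbedding.exists_regular_level_of_collapseNullHomotopic`)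
is the datum consumed by the regular value theorem (`RegularValuePreimage.lean`): a `C^∞` map
`g : ℝᴺ → ℝᵏ`, a value `y`, an open set `O ⊆ ℝᴺ ∖ 0` and `δ > 0` with

* `y` a regular value of `g` on `O`;
* `{p ∈ O | g p = y, 1 ≤ ‖p‖}` compact (it lies in the shell `‖p‖ ≤ 3/2`, beyond which the
  homotopy has reached the constant `∞`);
* on the shell `1 - δ < ‖p‖ < 1 + δ`, the level `O ∩ g⁻¹(y)` is *exactly* the open cone over
  the slice `tube(M × {y}) ⊆ Sⁿ⁺ᵏ` — so that the part `‖p‖ ≥ 1` of the level is a compact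
  manifold with boundary the copy `tube(M × {y})` of `M`.

Everything here is proved; no definitions, no named facts.

## References

* M. Kervaire, J. Milnor, *Groups of homotopy spheres I*, Ann. of Math. (2) 77 (1963),
  Lemma 4.2 and its proof (p. 510). doi:10.2307/1970128 [KervaireMilnorAnnals1963]
* A. Kosinski, *Differential Manifolds* (1993), Ch. IV (1.4) (transversality to a point via
  Sard), Ch. IX (5.5) (the Pontriagin construction is bijective). [Kosinski1993]
* J. Milnor, *Topology from the Differentiable Viewpoint* (1965), §7 (the Pontryagin
  construction), §3 (Sard, Brown). [MilnorTDV1965]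
-/

open scoped Manifold ContDiff Topology
open Set Function Metric Filter

noncomputable section

namespace Literature.Topology.FourManifolds

namespace FramedTubularEmbedding

variable {n k : ℕ} {M : Type*} [TopologicalSpace M] [ChartedSpace (EuclideanSpace ℝ (Fin n)) M]
  [CompactSpace M]

/-- On the tube, the collapse takes a finite value exactly at the points `tube (x, v)`, where it
is `v`: if `p(M, φ)(q) = v ∈ ℝᵏ` then `q = tube (x, v)` for some `x` (off the tube the collapse
is `∞`). [cite: Kosinski1993, Ch. IX §5, p. 179] -/
theorem exists_tube_eq_of_collapse_eq_coe (E : FramedTubularEmbedding n k M)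
    {q : sphere (0 : EuclideanSpace ℝ (Fin (n + k + 1))) 1} {v : EuclideanSpace ℝ (Fin k)}
    (h : E.collapse q = (v : OnePoint (EuclideanSpace ℝ (Fin k)))) :
    ∃ x : M, E.tube (x, v) = q := by
  by_cases hq : q ∈ range E.tube
  · obtain ⟨⟨x, w⟩, rfl⟩ := hq
    rw [E.collapse_tube] at h
    exact ⟨x, by rw [OnePoint.coe_injective h]⟩
  · rw [E.collapse_of_notMem hq] at h
    exact (OnePoint.infty_ne_coe v h).elim

/-- **The transversality datum of Kervaire–Milnor's Lemma 4.2.**  Let `E` be a framed tubular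
embedding of the compact `n`-manifold `M` into `Sⁿ⁺ᵏ` whose Pontryagin–Thom collapse is
null-homotopic.  Then there are a `C^∞` map `g : ℝⁿ⁺ᵏ⁺¹ → ℝᵏ`, a value `y ∈ ℝᵏ`, an open set
`O ⊆ ℝⁿ⁺ᵏ⁺¹ ∖ 0` and `δ ∈ (0, 1)` such that: `y` is a regular value of `g` on `O`; the part
`‖p‖ ≥ 1` of the level `O ∩ g⁻¹(y)` is compact; and on the shell `1 - δ < ‖p‖ < 1 + δ` the level
`O ∩ g⁻¹(y)` is exactly the cone over the slice `tube (M × {y})` of the tube.  (Kervaire–Milnor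
1963, proof of Lemma 4.2: the null-homotopy `Sⁿ⁺ᵏ × [0, 1] → Sᵏ` of `p(M, φ)`, read radially on
`ℝⁿ⁺ᵏ⁺¹ ∖ 0`, made smooth near and transverse to a point `y` near `0` by smooth approximation
relative to the tube end and Sard's theorem; Kosinski IV (1.4), IX (5.5).)
[cite: KervaireMilnorAnnals1963, Lemma 4.2 (proof), p. 510] -/
theorem exists_regular_level_of_collapseNullHomotopic [Nonempty M]
    (E : FramedTubularEmbedding n k M) (hE : E.CollapseNullHomotopic) :
    ∃ (g : EuclideanSpace ℝ (Fin (n + k + 1)) → EuclideanSpace ℝ (Fin k))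
      (y : EuclideanSpace ℝ (Fin k))
      (O : Set (EuclideanSpace ℝ (Fin (n + k + 1)))) (δ : ℝ),
      ContDiff ℝ ∞ g ∧ IsOpen O ∧ 0 < δ ∧ δ < 1 ∧ O ⊆ {0}ᶜ ∧
      (∀ p ∈ O, g p = y → Surjective (fderiv ℝ g p)) ∧
      IsCompact {p | p ∈ O ∧ g p = y ∧ 1 ≤ ‖p‖} ∧
      ∀ p, 1 - δ < ‖p‖ → ‖p‖ < 1 + δ →
        ((p ∈ O ∧ g p = y) ↔
          ∃ x : M, ‖p‖⁻¹ • p = (E.tube (x, y) : EuclideanSpace ℝ (Fin (n + k + 1)))) := by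
  classical
  -- `Fact (finrank ℝ ℝⁿ⁺ᵏ⁺¹ = n + k + 1)`, under which Mathlib charts the round sphere `Sⁿ⁺ᵏ`
  haveI : Fact (Module.finrank ℝ (EuclideanSpace ℝ (Fin (n + k + 1))) = n + k + 1) :=
    ⟨finrank_euclideanSpace_fin⟩
  -- notation
  obtain ⟨H⟩ := hE
  set A := EuclideanSpace ℝ (Fin (n + k + 1)) with hA
  have hNM : Nonempty M := inferInstance
  obtain ⟨x₀⟩ := hNM
  set θ₀ : sphere (0 : A) 1 := E.tube (x₀, 0) with hθ₀
  -- radial reading of the homotopy: direction and clamped time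
  set dir : A → sphere (0 : A) 1 := unitDir θ₀ with hdir
  set τ : A → unitInterval := fun p ↦ projIcc (0 : ℝ) 1 zero_le_one (4 * ‖p‖ - 5) with hτ
  have hτc : Continuous τ := continuous_projIcc.comp ((continuous_const.mul continuous_norm).sub
    continuous_const)
  have hτ0 : ∀ p : A, ‖p‖ ≤ 5 / 4 → τ p = 0 := fun p hp ↦ by
    rw [hτ]
    simp only
    rw [projIcc_of_le_left _ (by linarith)]
    rfl
  have hτ1 : ∀ p : A, 3 / 2 ≤ ‖p‖ → τ p = 1 := fun p hp ↦ by
    rw [hτ]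
    simp only
    rw [projIcc_of_right_le _ (by linarith)]
    rfl
  set Hc : A → OnePoint (EuclideanSpace ℝ (Fin k)) := fun p ↦ H (τ p, dir p) with hHc
  have hHc_cont : ContinuousOn Hc {0}ᶜ :=
    H.continuous.comp_continuousOn (hτc.continuousOn.prodMk (continuousOn_unitDir θ₀))
  have hHc0 : ∀ p : A, ‖p‖ ≤ 5 / 4 → Hc p = E.collapse (dir p) := fun p hp ↦ by
    rw [hHc]
    simp only
    rw [hτ0 p hp]
    exact H.apply_zero _
  have hHc1 : ∀ p : A, 3 / 2 ≤ ‖p‖ → Hc p = OnePoint.infty := fun p hp ↦ by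
    rw [hHc]
    simp only
    rw [hτ1 p hp]
    exact H.apply_one _
  -- the cut-offs `ρ` (values) and `λ` (radius)
  set ρ : ℝ → ℝ := fun s ↦ min 1 (max 0 (2 - s / 3)) with hρ
  have hρc : Continuous ρ := continuous_const.min (continuous_const.max
    (continuous_const.sub (continuous_id.div_const _)))
  have hρ3 : ∀ s, s ≤ 3 → ρ s = 1 := fun s hs ↦ by
    rw [hρ]; simp only; rw [min_eq_left]; exact le_max_of_le_right (by linarith)
  have hρ6 : ∀ s, 6 ≤ s → ρ s = 0 := fun s hs ↦ by
    rw [hρ]; simp only; rw [max_eq_left (by linarith), min_eq_right zero_le_one]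
  have hρ01 : ∀ s, 0 ≤ ρ s ∧ ρ s ≤ 1 := fun s ↦
    ⟨le_min zero_le_one (le_max_left _ _), min_le_left _ _⟩
  set θ : OnePoint (EuclideanSpace ℝ (Fin k)) → EuclideanSpace ℝ (Fin k) :=
    fun w ↦ OnePoint.elim w 0 (fun v ↦ ρ ‖v‖ • v) with hθ
  have hθcoe : ∀ v : EuclideanSpace ℝ (Fin k), θ v = ρ ‖v‖ • v := fun v ↦ rfl
  have hθinf : θ OnePoint.infty = 0 := rfl
  have hθ3 : ∀ v : EuclideanSpace ℝ (Fin k), ‖v‖ < 3 → θ v = v := fun v hv ↦ by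
    rw [hθcoe, hρ3 _ hv.le, one_smul]
  have hθc : Continuous θ := by
    rw [OnePoint.continuous_iff]
    refine ⟨?_, (hρc.comp continuous_norm).smul continuous_id⟩
    -- `θ = 0` outside the closed ball of radius `6`
    rw [hθinf, hasBasis_coclosedCompact.tendsto_left_iff]
    intro s hs
    refine ⟨closedBall 0 6, ⟨isClosed_closedBall, isCompact_closedBall _ _⟩, fun v hv ↦ ?_⟩
    have hv6 : 6 ≤ ‖v‖ := by
      rw [mem_compl_iff, mem_closedBall, dist_zero_right, not_le] at hv
      exact hv.le
    show θ v ∈ s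
    rw [hθcoe, hρ6 _ hv6, zero_smul]
    exact mem_of_mem_nhds hs
  set lam : ℝ → ℝ := fun s ↦ min 1 (max 0 (4 * s - 1)) with hlam
  have hlamc : Continuous lam := continuous_const.min (continuous_const.max
    ((continuous_const.mul continuous_id).sub continuous_const))
  have hlam_half : ∀ s, 1 / 2 ≤ s → lam s = 1 := fun s hs ↦ by
    rw [hlam]; simp only; rw [min_eq_left]; exact le_max_of_le_right (by linarith)
  have hlam_quarter : ∀ s, s ≤ 1 / 4 → lam s = 0 := fun s hs ↦ by
    rw [hlam]; simp only; rw [max_eq_left (by linarith), min_eq_right zero_le_one]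
  -- the continuous cut-off reading `f` of the homotopy
  set f : A → EuclideanSpace ℝ (Fin k) := fun p ↦ lam ‖p‖ • θ (Hc p) with hf
  have hf_cont : Continuous f := by
    rw [continuous_iff_continuousAt]
    intro p
    by_cases hp : p = 0
    · -- `f = 0` near `0`
      have hev : f =ᶠ[𝓝 p] fun _ ↦ 0 := by
        have : ball p (1 / 4) ∈ 𝓝 p := ball_mem_nhds p (by norm_num)
        filter_upwards [this] with q hq
        rw [hp, mem_ball, dist_zero_right] at hq
        show lam ‖q‖ • θ (Hc q) = 0
        rw [hlam_quarter _ hq.le, zero_smul]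
      exact (continuousAt_const.congr hev.symm)
    · exact ((hlamc.comp continuous_norm).continuousAt).smul
        (hθc.continuousAt.comp (hHc_cont.continuousAt (isOpen_compl_singleton.mem_nhds hp)))
  -- the normal coordinate `v` of the tube, read radially: smooth on the open cone `C₀`
  have hinj : Injective E.tube := E.isSmoothEmbedding.isEmbedding.injective
  set tinv : sphere (0 : A) 1 → M × EuclideanSpace ℝ (Fin k) := invFun E.tube with htinv
  have htinv_apply : ∀ q : M × EuclideanSpace ℝ (Fin k), tinv (E.tube q) = q :=
    leftInverse_invFun hinj
  have htube_tinv : ∀ {q : sphere (0 : A) 1}, q ∈ range E.tube → E.tube (tinv q) = q :=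
    fun hq ↦ invFun_eq hq
  set v : A → EuclideanSpace ℝ (Fin k) := fun p ↦ (tinv (dir p)).2 with hv
  set C₀ : Set A := {0}ᶜ ∩ dir ⁻¹' range E.tube with hC₀
  have hC₀_open : IsOpen C₀ :=
    (continuousOn_unitDir θ₀).isOpen_inter_preimage isOpen_compl_singleton E.isOpen_range
  have hdir_smooth : ContMDiffOn 𝓘(ℝ, A) (𝓡 (n + k)) ∞ dir {0}ᶜ := contMDiffOn_unitDir θ₀
  have htinv_smooth : ContMDiffOn (𝓡 (n + k)) ((𝓡 n).prod 𝓘(ℝ, EuclideanSpace ℝ (Fin k))) ∞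
      tinv (range E.tube) :=
    Literature.Geometry.Manifold.contMDiffOn_invFun_range E.isSmoothEmbedding
  have hv_smooth : ContDiffOn ℝ ∞ v C₀ := by
    rw [← contMDiffOn_iff_contDiffOn]
    have h1 : ContMDiffOn 𝓘(ℝ, A) ((𝓡 n).prod 𝓘(ℝ, EuclideanSpace ℝ (Fin k))) ∞
        (tinv ∘ dir) C₀ :=
      htinv_smooth.comp (hdir_smooth.mono inter_subset_left) fun p hp ↦ hp.2
    exact contMDiff_snd.comp_contMDiffOn h1
  have hv_cont : ContinuousOn v C₀ := hv_smooth.continuousOn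
  -- where `f` is the normal coordinate: the open set `U` and the compact `S ⊆ U`
  set U : Set A := C₀ ∩ v ⁻¹' ball 0 3 ∩ {p | 1 / 2 < ‖p‖ ∧ ‖p‖ < 5 / 4} with hU
  have hU_open : IsOpen U := by
    refine (hv_cont.isOpen_inter_preimage hC₀_open isOpen_ball).inter ?_
    exact (isOpen_lt continuous_const continuous_norm).inter
      (isOpen_lt continuous_norm continuous_const)
  have hfU_eq : ∀ p ∈ U, f p = v p := by
    rintro p ⟨⟨⟨hp0, hpr⟩, hv3⟩, hp1, hp2⟩
    have hHcp : Hc p = (v p : OnePoint (EuclideanSpace ℝ (Fin k))) := by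
      rw [hHc0 p hp2.le, ← htube_tinv hpr, E.collapse_tube]
    show lam ‖p‖ • θ (Hc p) = v p
    rw [hHcp, hθ3 _ (by simpa using hv3), hlam_half _ hp1.le, one_smul]
  have hfU : ContDiffOn ℝ ∞ f U :=
    (hv_smooth.mono fun p hp ↦ hp.1.1).congr hfU_eq
  set S : Set A := (fun q : A × ℝ ↦ q.2 • q.1) ''
    ((((↑) : sphere (0 : A) 1 → A) '' (E.tube '' (univ ×ˢ closedBall 0 2))) ×ˢ
      Icc (3 / 4 : ℝ) (9 / 8)) with hS
  have hS_compact : IsCompact S := by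
    refine IsCompact.image ?_ (continuous_snd.smul continuous_fst)
    refine IsCompact.prod ?_ isCompact_Icc
    exact ((isCompact_univ.prod (isCompact_closedBall _ _)).image
      E.isSmoothEmbedding.isEmbedding.continuous).image continuous_subtype_val
  have hS_closed : IsClosed S := hS_compact.isClosed
  -- membership in `S`
  have hmemS : ∀ (x : M) (w : EuclideanSpace ℝ (Fin k)) (r : ℝ), ‖w‖ ≤ 2 → 3 / 4 ≤ r →
      r ≤ 9 / 8 → r • (E.tube (x, w) : A) ∈ S := fun x w r hw hr1 hr2 ↦
    ⟨((E.tube (x, w) : A), r), ⟨⟨E.tube (x, w), ⟨(x, w), ⟨mem_univ _, by simpa using hw⟩, rfl⟩,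
      rfl⟩, hr1, hr2⟩, rfl⟩
  have hnorm_smul_tube : ∀ (q : sphere (0 : A) 1) (r : ℝ), 0 ≤ r → ‖r • (q : A)‖ = r :=
    fun q r hr ↦ by rw [norm_smul, norm_eq_of_mem_sphere, mul_one, Real.norm_of_nonneg hr]
  have hdir_smul : ∀ (q : sphere (0 : A) 1) (r : ℝ), 0 < r → dir (r • (q : A)) = q :=
    fun q r hr ↦ unitDir_smul θ₀ q hr
  have hSU : S ⊆ U := by
    rintro _ ⟨⟨_, r⟩, ⟨⟨_, ⟨⟨x, w⟩, ⟨-, hw⟩, rfl⟩, rfl⟩, hr1, hr2⟩, rfl⟩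
    have hw2 : ‖w‖ ≤ 2 := by simpa using hw
    have hr0 : 0 < r := by linarith [hr1]
    have hne : r • (E.tube (x, w) : A) ≠ 0 := by
      intro h0
      have := hnorm_smul_tube (E.tube (x, w)) r hr0.le
      rw [h0, norm_zero] at this
      linarith
    have hd : dir (r • (E.tube (x, w) : A)) = E.tube (x, w) := hdir_smul _ r hr0
    refine ⟨⟨⟨hne, ?_⟩, ?_⟩, ?_, ?_⟩
    · show dir (r • (E.tube (x, w) : A)) ∈ range E.tube
      rw [hd]; exact mem_range_self _
    · show (tinv (dir (r • (E.tube (x, w) : A)))).2 ∈ ball 0 3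
      rw [hd, htinv_apply]
      simpa using (show ‖w‖ < 3 by linarith)
    · show 1 / 2 < ‖r • (E.tube (x, w) : A)‖
      rw [hnorm_smul_tube _ r hr0.le]; linarith
    · show ‖r • (E.tube (x, w) : A)‖ < 5 / 4
      rw [hnorm_smul_tube _ r hr0.le]; linarith
  -- smooth approximation `g` of `f`, equal to `f` on `S`
  obtain ⟨g, hg, hgf, hgS, -⟩ := hf_cont.exists_contDiff_approx_and_eqOn ⊤
    (ε := fun _ ↦ (1 / 8 : ℝ)) continuous_const (fun _ ↦ by norm_num) hS_closed
    (hU_open.mem_nhdsSet.2 hSU) hfU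
  -- a regular value `y` of `g` with `‖y‖ < 1/8` (Sard)
  obtain ⟨y, hy, hreg⟩ := Literature.Analysis.Calculus.sard_holds.exists_regularValue_of_isOpen
    g univ isOpen_univ hg.contDiffOn isOpen_ball ⟨(0 : EuclideanSpace ℝ (Fin k)),
      mem_ball_self (by norm_num : (0 : ℝ) < 1 / 8)⟩
  have hy' : ‖y‖ < 1 / 8 := by simpa using hy
  -- the open set `O`
  set O₁ : Set A := {0}ᶜ ∩ {p | 3 / 4 < ‖p‖} with hO₁
  have hO₁_open : IsOpen O₁ :=
    isOpen_compl_singleton.inter (isOpen_lt continuous_const continuous_norm)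
  set B₃ : Set (OnePoint (EuclideanSpace ℝ (Fin k))) :=
    (↑) '' ball (0 : EuclideanSpace ℝ (Fin k)) 3 with hB₃
  have hB₃_open : IsOpen B₃ := OnePoint.isOpen_image_coe.2 isOpen_ball
  set O : Set A := O₁ ∩ Hc ⁻¹' B₃ with hO
  have hO_open : IsOpen O :=
    (hHc_cont.mono inter_subset_left).isOpen_inter_preimage hO₁_open hB₃_open
  -- key computation: on `O ∩ {1/2 ≤ ‖p‖}`, `f p` is the finite value of `Hc p`, close to `g p`
  have hfin : ∀ p ∈ O, ∃ h : EuclideanSpace ℝ (Fin k), ‖h‖ < 3 ∧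
      Hc p = (h : OnePoint (EuclideanSpace ℝ (Fin k))) ∧ (1 / 2 ≤ ‖p‖ → f p = h) := by
    rintro p ⟨⟨hp0, hp34⟩, ⟨h, hh3, hHc⟩⟩
    have hh3' : ‖h‖ < 3 := by simpa using hh3
    refine ⟨h, hh3', hHc.symm, fun hp ↦ ?_⟩
    show lam ‖p‖ • θ (Hc p) = h
    rw [← hHc, hθ3 _ hh3', hlam_half _ hp, one_smul]
  have hclose : ∀ p, ‖g p - f p‖ < 1 / 8 := fun p ↦ by rw [← dist_eq_norm]; exact hgf p
  have hnear : ∀ p (h : EuclideanSpace ℝ (Fin k)), g p = y → f p = h → ‖h‖ < 1 / 4 := by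
    intro p h hgp hfp
    have h1 := hclose p
    rw [hgp, hfp] at h1
    calc ‖h‖ = ‖y - (y - h)‖ := by rw [sub_sub_cancel]
      _ ≤ ‖y‖ + ‖y - h‖ := norm_sub_le _ _
      _ < 1 / 8 + 1 / 8 := add_lt_add hy' h1
      _ = 1 / 4 := by norm_num
  refine ⟨g, y, O, 1 / 8, hg, hO_open, by norm_num, by norm_num, fun p hp ↦ hp.1.1,
    fun p hp hgp ↦ hreg p (mem_univ _) hgp, ?_, ?_⟩
  · -- compactness of the part `‖p‖ ≥ 1` of the level
    set Q : Set (OnePoint (EuclideanSpace ℝ (Fin k))) :=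
      (↑) '' closedBall (0 : EuclideanSpace ℝ (Fin k)) (1 / 4) with hQ
    have hQ_closed : IsClosed Q :=
      OnePoint.isClosed_image_coe.2 ⟨isClosed_closedBall, isCompact_closedBall _ _⟩
    set K' : Set A := ({p : A | 1 ≤ ‖p‖} ∩ Hc ⁻¹' Q) ∩ g ⁻¹' {y} with hK'
    have hK'_closed : IsClosed K' := by
      refine IsClosed.inter ?_ (isClosed_singleton.preimage hg.continuous)
      refine (hHc_cont.mono ?_).preimage_isClosed_of_isClosed
        (isClosed_le continuous_const continuous_norm) hQ_closed
      intro p hp h0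
      have h0' : p = 0 := h0
      have hp' : 1 ≤ ‖p‖ := hp
      rw [h0', norm_zero] at hp'
      exact absurd hp' (by norm_num)
    have hK'_bdd : Bornology.IsBounded K' := by
      refine (isBounded_closedBall (x := (0 : A)) (r := 3 / 2)).subset ?_
      rintro p ⟨⟨-, hpQ⟩, -⟩
      rw [mem_closedBall, dist_zero_right]
      by_contra hlt
      push Not at hlt
      have : Hc p = OnePoint.infty := hHc1 p hlt.le
      rw [mem_preimage, this] at hpQ
      exact OnePoint.infty_notMem_image_coe hpQ
    have hKK' : {p | p ∈ O ∧ g p = y ∧ 1 ≤ ‖p‖} = K' := by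
      ext p
      constructor
      · rintro ⟨hpO, hgp, hp1⟩
        obtain ⟨h, hh3, hHc, hfp⟩ := hfin p hpO
        have hhy : ‖h‖ < 1 / 4 := hnear p h hgp (hfp (by linarith))
        exact ⟨⟨hp1, ⟨h, by simpa using hhy.le, hHc.symm⟩⟩, hgp⟩
      · rintro ⟨⟨hp1, ⟨h, hh, hHc⟩⟩, hgp⟩
        have hh' : ‖h‖ ≤ 1 / 4 := by simpa using hh
        have hp1' : 1 ≤ ‖p‖ := hp1
        have hp0 : p ≠ 0 := by
          intro h0; rw [h0, norm_zero] at hp1'; exact absurd hp1' (by norm_num)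
        have hp34 : 3 / 4 < ‖p‖ := by linarith
        have hh3 : ‖h‖ < 3 := by linarith
        exact ⟨⟨⟨hp0, hp34⟩, ⟨h, by simpa using hh3, hHc⟩⟩, hgp, hp1⟩
    rw [hKK']
    exact Metric.isCompact_of_isClosed_isBounded hK'_closed hK'_bdd
  · -- the level on the shell `7/8 < ‖p‖ < 9/8` is the cone over the slice `tube (M × {y})`
    intro p hp1 hp2
    have hp1' : 7 / 8 < ‖p‖ := by linarith
    have hp2' : ‖p‖ < 9 / 8 := by linarith
    constructor
    · rintro ⟨hpO, hgp⟩
      have hp0 : p ≠ 0 := hpO.1.1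
      obtain ⟨h, hh3, hHc, hfp⟩ := hfin p hpO
      have hfp' := hfp (by linarith)
      -- the collapse of `dir p` is `h`: `dir p = tube (x, h)`
      have hcol : E.collapse (dir p) = (h : OnePoint (EuclideanSpace ℝ (Fin k))) := by
        rw [← hHc0 p (by linarith), hHc]
      obtain ⟨x, hx⟩ := E.exists_tube_eq_of_collapse_eq_coe hcol
      -- `‖h‖ < 1/4`, so `p ∈ S`, where `g = f`; hence `h = y`
      have hhy : ‖h‖ ≤ 2 := by linarith [hnear p h hgp hfp']
      have hpS : p ∈ S := by
        have := hmemS x h ‖p‖ hhy (by linarith) (by linarith)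
        rwa [hx, norm_smul_coe_unitDir θ₀ hp0] at this
      have hhy' : h = y := by
        have := hgS hpS
        rw [hgp, hfp'] at this
        exact this.symm
      refine ⟨x, ?_⟩
      rw [← coe_unitDir_of_ne θ₀ hp0, ← hhy', hx]
    · rintro ⟨x, hx⟩
      have hp0 : p ≠ 0 := by
        intro h0
        have := congrArg (fun q : A ↦ ‖q‖) hx
        simp only [h0, smul_zero, norm_zero, norm_eq_of_mem_sphere] at this
        exact zero_ne_one this
      have hd : dir p = E.tube (x, y) :=
        Subtype.ext (by rw [← hx]; exact coe_unitDir_of_ne θ₀ hp0)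
      have hHcp : Hc p = (y : OnePoint (EuclideanSpace ℝ (Fin k))) := by
        rw [hHc0 p (by linarith), hd, E.collapse_tube]
      have hy3 : ‖y‖ < 3 := by linarith
      have hpO : p ∈ O := ⟨⟨hp0, by show 3 / 4 < ‖p‖; linarith⟩,
        ⟨y, by simpa using hy3, hHcp.symm⟩⟩
      refine ⟨hpO, ?_⟩
      have hpS : p ∈ S := by
        have := hmemS x y ‖p‖ (by linarith) (by linarith) (by linarith)
        rwa [← hx, smul_smul, mul_inv_cancel₀ (norm_ne_zero_iff.2 hp0), one_smul] at this
      rw [hgS hpS]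
      show lam ‖p‖ • θ (Hc p) = y
      rw [hHcp, hθ3 _ hy3, hlam_half _ (by linarith), one_smul]

end FramedTubularEmbedding

end Literature.Topology.FourManifolds

end
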